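import Mathlib
import HarnessLib
import Summits.NavierStokesRegularity.NavierStokesRegularity.Theorems.PoloidalWindowDoorPoloidalWindowRigiditySparseEnergyRounds

/-!
# Route `PoloidalWindowDoor`, crux `PoloidalWindowRigidity` (stmt-19708), line `sparse_energy` (cstrat g11) —
# stub S1 `stub_scaledEnergy` MODULO THE WINDOW PRESSURE SPLIT

Seat ns-poloidal-K2-p2 g9 (successor of the interim LEAD-of-record on 19708; file `--supports`).  Assembly of the two halves of S1:

* far from the apex (`t₀ ≤ −R²`): `…SparseEnergyFarField.scaledEnergy_far` (unconditional);
* near the apex (`−R² < t₀ < 0`): `…SparseEnergyRounds.envelope_zero` (three power-law rounds of the local energy inequality, CONDITIONAL on the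
  window pressure split `hwin` — the consumer form of the Literature brick `pressure of a bounded mild solution = RᵢRⱼ(vᵢvⱼ) mod constants`
  being typed by ns-es-p1), converted to the ball / `∫⁻ … ENNReal.ofReal` currency of the stub exactly as in `…FarField.ballDissipation_le_far`.

`scaledEnergy_of_split` — S1's conclusion VERBATIM (`∃ K ≥ 0, ∀ t₀ < 0, ∀ a R, 0 < R → ∫⁻_{B(a,R)}‖v t₀‖² ≤ K·R ∧ ∫⁻_{t<t₀}∫⁻_{B(a,R)}‖Dv(t)‖² ≤ K·R`)
from S1's four hypotheses plus `hwin`.  What remains of `stub_scaledEnergy` after this file is ONLY the discharge of `hwin` for the Type-I class.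

WHAT THIS IS NOT: not a claim about Navier–Stokes regularity or blow-up; a conditional local-energy estimate (bears_on LADDER-NS N0 via crux 19708,
line sparse_energy, stub S1). [folklore]
-/

noncomputable section

-- the summit and its single sub-problem share the name (CONVENTIONS §1), as in every Theorems file
set_option linter.dupNamespace false

namespace Summit.NavierStokesRegularity.NavierStokesRegularity.Theorems.PoloidalWindowDoorPoloidalWindowRigiditySparseEnergyScaledEnergyOfSplit

open MeasureTheory Set Function Filter Topology Metric intervalIntegral
open scoped RealInnerProductSpace InnerProductSpace Laplacian ENNReal
open Literature.Analysis Literature.Analysis.FluidPDE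
open Summit.NavierStokesRegularity.NavierStokesRegularity.Theorems.PoloidalWindowDoorPoloidalWindowRigiditySparseEnergyFarFlux
open Summit.NavierStokesRegularity.NavierStokesRegularity.Theorems.PoloidalWindowDoorPoloidalWindowRigiditySparseEnergyFarField
open Summit.NavierStokesRegularity.NavierStokesRegularity.Theorems.PoloidalWindowDoorPoloidalWindowRigiditySparseEnergyRounds

variable {C : ℝ} {v : ℝ → EuclideanSpace ℝ (Fin 3) → EuclideanSpace ℝ (Fin 3)}

/-- **S1 (`stub_scaledEnergy`) MODULO THE WINDOW PRESSURE SPLIT.**  For a time-Type-I bounded, continuous, Oseen-mild, divergence-free ancient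
profile `v` on `(−∞,0) × ℝ³` whose window pressures split as in `hwin` (local `L²` part controlled by the local energy at scale `8R`, harmonic
remainder with oscillation controlled by the dyadic far sums), there is `K ≥ 0` with, for every `t₀ < 0`, centre `a` and radius `R > 0`,
`∫⁻_{B(a,R)} ‖v(t₀)‖² ≤ K·R` and `∫⁻_{t<t₀}∫⁻_{B(a,R)} ‖Dv(t)‖² ≤ K·R` — the conclusion of S1 verbatim. [folklore] -/
theorem scaledEnergy_of_split (hrate : HasTypeITimeDecay C v)
    (hcont : ContinuousOn (uncurry v) (Iio (0 : ℝ) ×ˢ univ))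
    (hmild : ∀ s t : ℝ, s < t → t < 0 → ∀ x,
      v t x = UnboundedOperators.heatExtension (v s) (t - s) x - oseenDuhamel 1 s v v t x)
    (hdiv : ∀ t < 0, VectorCalculus.IsDivFree (v t)) {κ₁ κ₂ : ℝ} (hκ₁ : 0 ≤ κ₁) (hκ₂ : 0 ≤ κ₂)
    (hwin : ∀ T : ℝ, T < 0 → ∃ q : ℝ → EuclideanSpace ℝ (Fin 3) → ℝ, IsClassicalNSSolutionOn (Ioo T 0) 1 0 v q ∧
      ∀ t ∈ Ioo T 0, ∀ (a : EuclideanSpace ℝ (Fin 3)) (R : ℝ), 0 < R →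
        ∃ (c : ℝ) (p₁ p₂ : EuclideanSpace ℝ (Fin 3) → ℝ), Continuous p₁ ∧ (∀ x ∈ closedBall a (2 * R), q t x = c + p₁ x + p₂ x) ∧
          Real.sqrt (∫ x in closedBall a (2 * R), p₁ x ^ 2) ≤
            κ₁ * (C / Real.sqrt (-t)) * Real.sqrt (∫ x, cutoff (8 * R) (a - x) * ‖v t x‖ ^ 2) ∧
          ∃ O : ℝ, 0 ≤ O ∧ (∀ x ∈ closedBall a (2 * R), ∀ y ∈ closedBall a (2 * R), |p₂ x - p₂ y| ≤ O) ∧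
            O ≤ κ₂ * R * ∑' k : ℕ, ((2 : ℝ) ^ k * R)⁻¹ ^ 4 * ∫ x, cutoff ((2 : ℝ) ^ (k + 1) * R) (a - x) * ‖v t x‖ ^ 2) :
    ∃ K : ℝ, 0 ≤ K ∧ ∀ t₀ < 0, ∀ (a : EuclideanSpace ℝ (Fin 3)) (R : ℝ), 0 < R →
      (∫⁻ x in ball a R, ENNReal.ofReal (‖v t₀ x‖ ^ 2)) ≤ ENNReal.ofReal (K * R) ∧
      (∫⁻ t in Iio t₀, ∫⁻ x in ball a R, ENNReal.ofReal (‖fderiv ℝ (v t) x‖ ^ 2)) ≤ ENNReal.ofReal (K * R) := by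
  obtain ⟨Kf, hKf0, hfar⟩ := scaledEnergy_far hrate hcont hmild hdiv
  obtain ⟨K₃, hK₃0, hE, hD⟩ := envelope_zero hrate hcont hmild hdiv hκ₁ hκ₂ hwin
  refine ⟨Kf + K₃, by positivity, fun t₀ ht₀ a R hR => ?_⟩
  have hKfR : ENNReal.ofReal (Kf * R) ≤ ENNReal.ofReal ((Kf + K₃) * R) :=
    ENNReal.ofReal_le_ofReal (mul_le_mul_of_nonneg_right (by linarith) hR.le)
  have hK₃R : ENNReal.ofReal (K₃ * R) ≤ ENNReal.ofReal ((Kf + K₃) * R) :=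
    ENNReal.ofReal_le_ofReal (mul_le_mul_of_nonneg_right (by linarith) hR.le)
  rcases le_or_gt t₀ (-R ^ 2) with hfarcase | hnear
  · -- far from the apex: both conjuncts from `scaledEnergy_far`
    obtain ⟨h1, h2⟩ := hfar t₀ ht₀ a R hR hfarcase
    exact ⟨h1.trans hKfR, h2.trans hKfR⟩
  -- near the apex
  have hR2 : 0 < R ^ 2 := by positivity
  set ψ : EuclideanSpace ℝ (Fin 3) → ℝ := fun x => cutoff R (a - x) with hψ
  have hψ0 : Continuous ψ := (cutoffT_contDiff hψ (n := 0)).continuous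
  have hψc : HasCompactSupport ψ := cutoffT_hasCompactSupport hψ hR
  constructor
  · -- (i) energy: the ball integral is dominated by the cut-off integral, which is `≤ K₃ R` on the near regime
    have hvc : Continuous (v t₀) := LocalSineTubeDoorProfileAlignedWindowRigidityAncient.continuous_slice hcont ht₀
    have hv2 : Continuous fun x => ‖v t₀ x‖ ^ 2 := (hvc.norm).pow 2
    have hfi : Integrable fun x => ψ x * ‖v t₀ x‖ ^ 2 :=
      ((cutoffT_contDiff hψ (n := 0)).continuous.mul hv2).integrable_of_hasCompactSupport hψc.mul_right
    have hball : ∫ x in ball a R, ‖v t₀ x‖ ^ 2 = ∫ x in ball a R, ψ x * ‖v t₀ x‖ ^ 2 := by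
      refine setIntegral_congr_fun measurableSet_ball fun x hx => ?_
      rw [cutoffT_eq_one hψ hR (le_of_lt (mem_ball.1 hx)), one_mul]
    have hle : ∫ x in ball a R, ‖v t₀ x‖ ^ 2 ≤ ∫ x, ψ x * ‖v t₀ x‖ ^ 2 := by
      rw [hball]
      exact setIntegral_le_integral hfi (Eventually.of_forall fun x => mul_nonneg (cutoffT_nonneg_le_one hψ x).1 (sq_nonneg _))
    have h1 : ∫ x in ball a R, ‖v t₀ x‖ ^ 2 ≤ K₃ * R := hle.trans (hE a R t₀ hR ht₀ (by linarith))
    have hint : IntegrableOn (fun x => ‖v t₀ x‖ ^ 2) (ball a R) :=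
      (hv2.continuousOn.integrableOn_compact (isCompact_closedBall a R)).mono_set ball_subset_closedBall
    rw [← ofReal_integral_eq_lintegral_ofReal hint (ae_of_all _ fun x => sq_nonneg _)]
    exact (ENNReal.ofReal_le_ofReal h1).trans hK₃R
  · -- (ii) dissipation: `(−∞, t₀) ⊆ (−∞, −R²) ∪ [−R², t₀]`; the first by the far half at `−R²`, the second by the near rounds
    have hsub : Iio t₀ ⊆ Iio (-R ^ 2) ∪ Icc (-R ^ 2) t₀ := by
      intro t ht
      rcases lt_or_ge t (-R ^ 2) with h | h
      · exact Or.inl h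
      · exact Or.inr ⟨h, le_of_lt ht⟩
    have hfar2 := (hfar (-R ^ 2) (by linarith) a R hR le_rfl).2
    -- the window `[−R², t₀]`
    obtain ⟨q, hcl, -⟩ := hwin (-R ^ 2 - 1) (by linarith)
    have hFnn : ∀ t x, 0 ≤ frobeniusNormSq (fderiv ℝ (v t) x) * ψ x := fun t x =>
      mul_nonneg (frobeniusNormSq_nonneg _) (cutoffT_nonneg_le_one hψ x).1
    have hInn : ∀ t, 0 ≤ ∫ x, frobeniusNormSq (fderiv ℝ (v t) x) * ψ x := fun t => integral_nonneg (hFnn t)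
    have hDc : ContinuousOn (fun t => ∫ x, frobeniusNormSq (fderiv ℝ (v t) x) * ψ x) (Ioo (-R ^ 2 - 1) 0) :=
      hcl.continuousOn_integral_dissipation_cutoff isOpen_Ioo hψ0 hψc
    have hslice : ∀ t ∈ Icc (-R ^ 2) t₀, (∫⁻ x in ball a R, ENNReal.ofReal (‖fderiv ℝ (v t) x‖ ^ 2)) ≤
        ENNReal.ofReal (∫ x, frobeniusNormSq (fderiv ℝ (v t) x) * ψ x) := by
      intro t ht
      have htS : t ∈ Ioo (-R ^ 2 - 1) 0 := ⟨by linarith [ht.1], lt_of_le_of_lt ht.2 ht₀⟩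
      have hu : ContDiff ℝ 1 (v t) := (hcl.smooth_velocity.contDiff_slice htS).of_le (by exact_mod_cast le_top)
      have hFc : Continuous fun x => frobeniusNormSq (fderiv ℝ (v t) x) * ψ x :=
        (LerayHopfProofs.continuous_frobeniusNormSq.comp (hu.continuous_fderiv one_ne_zero)).mul hψ0
      have hFi : Integrable fun x => frobeniusNormSq (fderiv ℝ (v t) x) * ψ x :=
        hFc.integrable_of_hasCompactSupport hψc.mul_left
      rw [ofReal_integral_eq_lintegral_ofReal hFi (ae_of_all _ (hFnn t))]
      calc (∫⁻ x in ball a R, ENNReal.ofReal (‖fderiv ℝ (v t) x‖ ^ 2))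
          ≤ ∫⁻ x in ball a R, ENNReal.ofReal (frobeniusNormSq (fderiv ℝ (v t) x) * ψ x) := by
            refine setLIntegral_mono hFc.measurable.ennreal_ofReal fun x hx => ENNReal.ofReal_le_ofReal ?_
            rw [cutoffT_eq_one hψ hR (le_of_lt (mem_ball.1 hx)), mul_one]
            exact SereginSverak2009.opNorm_sq_le_frobeniusNormSq' _
        _ ≤ ∫⁻ x, ENNReal.ofReal (frobeniusNormSq (fderiv ℝ (v t) x) * ψ x) := setLIntegral_le_lintegral _ _
    have hmono : (∫⁻ t in Icc (-R ^ 2) t₀, ∫⁻ x in ball a R, ENNReal.ofReal (‖fderiv ℝ (v t) x‖ ^ 2)) ≤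
        ∫⁻ t in Icc (-R ^ 2) t₀, ENNReal.ofReal (∫ x, frobeniusNormSq (fderiv ℝ (v t) x) * ψ x) :=
      setLIntegral_mono' measurableSet_Icc fun t ht => hslice t ht
    have hIc : ContinuousOn (fun t => ∫ x, frobeniusNormSq (fderiv ℝ (v t) x) * ψ x) (Icc (-R ^ 2) t₀) :=
      hDc.mono fun t ht => ⟨by linarith [ht.1], lt_of_le_of_lt ht.2 ht₀⟩
    have hIi : IntegrableOn (fun t => ∫ x, frobeniusNormSq (fderiv ℝ (v t) x) * ψ x) (Icc (-R ^ 2) t₀) :=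
      hIc.integrableOn_compact isCompact_Icc
    have hnear2 : (∫⁻ t in Icc (-R ^ 2) t₀, ∫⁻ x in ball a R, ENNReal.ofReal (‖fderiv ℝ (v t) x‖ ^ 2)) ≤ ENNReal.ofReal (K₃ * R) := by
      refine hmono.trans ?_
      rw [← ofReal_integral_eq_lintegral_ofReal hIi (ae_of_all _ fun t => hInn t)]
      refine ENNReal.ofReal_le_ofReal ?_
      have hK' := hD a R t₀ hR hnear ht₀
      rw [intervalIntegral.integral_of_le hnear.le, ← integral_Icc_eq_integral_Ioc] at hK'
      have hI0 : 0 ≤ ∫ t in Icc (-R ^ 2) t₀, ∫ x, frobeniusNormSq (fderiv ℝ (v t) x) * ψ x :=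
        setIntegral_nonneg measurableSet_Icc fun t _ => hInn t
      linarith
    calc (∫⁻ t in Iio t₀, ∫⁻ x in ball a R, ENNReal.ofReal (‖fderiv ℝ (v t) x‖ ^ 2))
        ≤ ∫⁻ t in Iio (-R ^ 2) ∪ Icc (-R ^ 2) t₀, ∫⁻ x in ball a R, ENNReal.ofReal (‖fderiv ℝ (v t) x‖ ^ 2) :=
          lintegral_mono_set hsub
      _ ≤ (∫⁻ t in Iio (-R ^ 2), ∫⁻ x in ball a R, ENNReal.ofReal (‖fderiv ℝ (v t) x‖ ^ 2)) +
            ∫⁻ t in Icc (-R ^ 2) t₀, ∫⁻ x in ball a R, ENNReal.ofReal (‖fderiv ℝ (v t) x‖ ^ 2) := lintegral_union_le _ _ _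
      _ ≤ ENNReal.ofReal (Kf * R) + ENNReal.ofReal (K₃ * R) := add_le_add hfar2 hnear2
      _ = ENNReal.ofReal ((Kf + K₃) * R) := by
          rw [← ENNReal.ofReal_add (mul_nonneg hKf0 hR.le) (mul_nonneg hK₃0 hR.le), add_mul]

end Summit.NavierStokesRegularity.NavierStokesRegularity.Theorems.PoloidalWindowDoorPoloidalWindowRigiditySparseEnergyScaledEnergyOfSplit

end
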